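import Literature.MathematicalPhysics.QuantumFieldTheory.Balaban1983to89.B6Eq295

/-!
# `Balaban1983to89.B6Eq297GaugeFixing` — T. Bałaban, *Propagators and renormalization transformations for lattice
# gauge theories. II*, Commun. Math. Phys. **96** (1984) 223–250 [Balaban1984PropagatorsII], Sect. C (2.95) ⇒ (2.97)
# p. 240: *"Let us apply (2.96) and (1.27) to the denominator. It defines the gauge fixing term introduced in Sect. C
# of [4], with blocks uniformly of order j. Let us denote the corresponding operator by P_j"* — the passage from the
# second line of (2.95) to (2.97), PROVED pointwise in `A` over the abstract carriers of `…B6Eq295`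

statement-level skeleton of published theorems with citation tags; proofs where landed; nothing here is a claim about the Yang–Mills mass gap

PDF held: `paper:balaban1984-cmp96-propagators-rt-ii` (journal page = PDF page + 222); p. 240 read AS IMAGE on the ×2
render `run/shared/lean/pub/pub-balaban/b2b-balaban-ref1/pages/1984-cmp96-propagators-rt-II/…-p018-x2.png` by this seat
(2026-08-21).

CITATION HEADER (lean-in-tree rule).  WHAT IS REPRODUCED: the member (2.97) of lit-balaban SKELETON row **B6.Eq2.95**
((2.95)–(2.97) p. 240; cell note of record, ROWS-B6 owner r03: *"(2.97) = (2.95) after (2.96) + (1.27) in the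
denominator — located, not retyped"*; `…B6Eq2106` §5 (r03 gen 4) STARTS from the (2.97) integrand: `eq2105_of_2097`).
This module is the bridge `…B6Eq295.eq295_first`/`eq295_gaugeFactor` ((2.95)) → (2.97) → `…B6Eq2106` ((2.105)–(2.106)).
PHASE-2 seat p22 (gen 5); owner r03, referee ref-4.  IMPORTS, restating nothing: `…B6Eq295` (`eq224` = (2.24), i.e.
*"(1.27) valid for this operator P also"*); the unit (2.96) enters as the displayed hypothesis `h296` (its content —
unimodularity of the block chart — is `…B6Eq296UnitJacobian`, this seat, p249622).

PRINT (p. 240 [PDF 18], verbatim).  *"e^{½⟨J,GJ⟩} = Z⁻¹∫dA exp[−½⟨QA,aQA⟩ − ½⟨A,(Δ−∂P∂*)A⟩ + ⟨A,J⟩]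
= Z⁻¹∫dA exp[−½⟨QA,aQA⟩ − ½⟨A,ΔA⟩ + ⟨A,J⟩] (Z′⁻¹∫dλδ(Q′λ)e^{−½‖∂*A−Δλ‖²})⁻¹
· [∫dω↾_Λδ(Q′₁ω) Π_{y∈Λ′}δ_{Ax(y)}(Q_jA+∂₁ω) Z′_j⁻¹∫dλ′δ(Q′_jλ′)e^{−½‖∂*A−Δλ′‖²}] /
  [∫dω′↾_Λδ(Q′₁ω′) Π_{y∈Λ′}δ_{Ax(y)}(Q_jA+∂₁ω′) Z′_j⁻¹∫dλ′δ(Q′_jλ′)e^{−½‖∂*A−Δλ′‖²}], (2.95)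
where we have used the identity (1.27) valid for this operator P also. The configurations ω, ω′ are defined on Λ and
from the definition of δ_Ax we have ∫dω′↾_Λδ(Q′₁ω′)Π_{y∈Λ′}δ_{Ax(y)}(Q_jA+∂₁ω′) = 1. (2.96) … The quotient in the last
line of (2.95) was introduced to change the gauge fixing term in the integral by the Faddeev-Popov procedure. Let us
apply (2.96) and (1.27) to the denominator. It defines the gauge fixing term introduced in Sect. C of [4], with blocks
uniformly of order j. Let us denote the corresponding operator by P_j. We have
e^{½⟨J,GJ⟩} = ∫dω↾_Λδ(Q′₁ω) Z⁻¹∫dA exp[−½aΣ_{b∈Λ^c}|(Q_jA)(b)|² − ½aL^{d−2}Σ_{c∈Λ′}|(Q_{j+1}A)(c)|² − ½‖∂A‖² − ½‖(I−P_j)∂*A‖²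
+ ⟨A,J⟩] · Π_{y∈Λ′}δ_{Ax(y)}(Q_jA+∂₁ω) Z′_j⁻¹∫dλ′δ(Q′_jλ′)e^{−½‖∂*A−Δλ′‖²} · (Z′⁻¹∫dλδ(Q′λ)e^{−½‖∂*A−Δλ‖²})⁻¹. (2.97)"*

TYPING (the convention of `…B6Eq295` / `…B6Eq2106` §5, every hypothesis displayed; pointwise in the configuration `a`
— the outer `Z⁻¹∫dA` and the order of the `A`- and `ω`-integrations are untouched, cf. `…B6Eq2106.eq2105_order`).
`B` = scalar functions, `A` = vector fields (real inner-product spaces); `∫dλ′δ(Q′_jλ′)(·)` = `∫ (·)(ι n) dμj` over the gauge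
group of order j (`ι : Nj →ₗ B`, `μj` left-invariant, `Δ` = `lap`), `Z′_j = ∫dλ′δ(Q′_jλ′)e^{−½‖Δλ′‖²}`; `R_j` = the orthogonal
projection onto `ΔN(Q′_j) = range (Δ∘ι)` (`hKj`, `hRj`) and `I − P_j = R_j`; the last factor `(Z′⁻¹∫dλδ(Q′λ)…)⁻¹` over
`N(Q′)` (`κ : NQ →ₗ B`, `μ'`) is carried along unchanged (`X`); the `ω`-integral is `∫ (·) dν` over a parameter space `N1`
with the product of the `δ_{Ax(y)}` written as a function `χ` of the block averages `Q_jA + ∂₁ω` (`χ (Qv a + sh ω)`, as in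
`…B6Eq2106`); (2.96) is the hypothesis `h296 : ∫ χ(Q_ja + ∂₁ω) dν(ω) = 1`; `½⟨QA,aQA⟩`, expanded by print into the two
block sums of (2.97), is an arbitrary function `q a` here; `⟨A,ΔA⟩ = ‖∂A‖² + ‖∂*A‖²` (`hΔ`, Δ = ∂*∂ + ∂∂* on vector
fields).

CONTENTS (all theorems; no definitions; standard axioms).  `inner_starProjection_eq_norm_sq` (`⟨f,R_jf⟩ = ‖R_jf‖²`),
**`eq127_j`** ((1.27) for `P_j`: `Z′_j⁻¹∫dλ′δ(Q′_jλ′)e^{−½‖f−Δλ′‖²} = e^{−½‖f‖² + ½⟨f,R_jf⟩}`, from `…B6Eq295.eq224`),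
**`den_eq`** (*"apply (2.96) and (1.27) to the denominator"*: the denominator of (2.95) equals `e^{−½‖∂*A‖²+½⟨∂*A,R_j∂*A⟩}`),
**`eq297_of_295`** (the (2.95)₂ integrand × the quotient = the `ω`-integral of the (2.97) integrand, for every `a`),
`eq297_integrand` (the (2.97) `ω`-integrand is `Z′·Z′_j⁻¹ ×` the integrand of `…B6Eq2106.eq2105_of_2097_fibre` with the
invariant weight `Φ(A) = exp[−½⟨QA,aQA⟩ − ½‖∂A‖² − ½‖(I−P_j)∂*A‖²]`).
HONEST SCOPE: abstract carriers; (2.96) as hypothesis (content in `…B6Eq296UnitJacobian`); value = kernel certificate of the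
displayed bookkeeping, NOT summit progress.  Unit `lit-balaban-p22` (gen 5), HOME `run/shared/lean/pub/lit-balaban/`.
-/

noncomputable section

open MeasureTheory
open scoped InnerProductSpace

namespace Literature.MathematicalPhysics.QuantumFieldTheory.Balaban1983to89.B6Eq297GaugeFixing

section

variable {A B W T N1 Nj NQ : Type*} [NormedAddCommGroup A] [InnerProductSpace ℝ A]
  [NormedAddCommGroup B] [InnerProductSpace ℝ B] [AddCommGroup W] [Module ℝ W]
  [NormedAddCommGroup T] [InnerProductSpace ℝ T] [MeasurableSpace N1]
  [AddCommGroup Nj] [Module ℝ Nj] [MeasurableSpace Nj] [MeasurableAdd Nj]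
  [AddCommGroup NQ] [Module ℝ NQ] [MeasurableSpace NQ]

omit [InnerProductSpace ℝ B] in
/-- `⟨f, R_jf⟩ = ‖R_jf‖²` for the orthogonal projection `R_j` (so `−½‖f‖² + ½⟨f,R_jf⟩ = −½‖(I−R_j)f‖²`: the printed
`−½‖(I−P_j)∂*A‖²` bookkeeping, `I − P_j = R_j`). [cite: Balaban1984PropagatorsII, (2.97) p.240] -/
theorem inner_starProjection_eq_norm_sq [InnerProductSpace ℝ B] (K : Submodule ℝ B) [K.HasOrthogonalProjection]
    (f : B) : ⟪f, K.starProjection f⟫_ℝ = ‖K.starProjection f‖ ^ 2 := by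
  have h0 : ⟪f - K.starProjection f, K.starProjection f⟫_ℝ = 0 :=
    Submodule.starProjection_inner_eq_zero f _ (K.starProjection_apply_mem f)
  rw [inner_sub_left, sub_eq_zero] at h0
  rw [h0, real_inner_self_eq_norm_sq]

/-- **"(1.27) valid for this operator P also", for `P_j`:** `Z′_j⁻¹ ∫dλ′δ(Q′_jλ′)e^{−½‖f−Δλ′‖²} = e^{−½‖f‖² + ½⟨f,R_jf⟩}`
(`Z′_j ≠ 0`), from (2.24) `…B6Eq295.eq224`. [cite: Balaban1984PropagatorsII, (2.95)–(2.97) p.240] -/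
theorem eq127_j (μj : Measure Nj) [μj.IsAddLeftInvariant] (lap : B →ₗ[ℝ] B) (ι : Nj →ₗ[ℝ] B)
    (Kj : Submodule ℝ B) [Kj.HasOrthogonalProjection] (hKj : LinearMap.range (lap ∘ₗ ι) = Kj) (Rj : B →ₗ[ℝ] B)
    (hRj : ∀ g, Rj g = Kj.starProjection g) (hZj : ∫ n, Real.exp (-(1 / 2) * ‖lap (ι n)‖ ^ 2) ∂μj ≠ 0) (f : B) :
    (∫ n, Real.exp (-(1 / 2) * ‖lap (ι n)‖ ^ 2) ∂μj)⁻¹ * ∫ n, Real.exp (-(1 / 2) * ‖f - lap (ι n)‖ ^ 2) ∂μj =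
      Real.exp (-(1 / 2) * ‖f‖ ^ 2 + (1 / 2) * ⟪f, Rj f⟫_ℝ) := by
  have h := B6Eq295.eq224 μj (lap ∘ₗ ι) Kj hKj Rj hRj f
  simp only [LinearMap.coe_comp, Function.comp_apply] at h
  -- h : e^{−½‖f‖²}·Z′_j = e^{−½⟨f,R_jf⟩}·∫e^{−½‖f−Δλ′‖²}
  rw [inv_mul_eq_iff_eq_mul₀ hZj]
  calc ∫ n, Real.exp (-(1 / 2) * ‖f - lap (ι n)‖ ^ 2) ∂μj
      = (Real.exp (-(1 / 2) * ⟪f, Rj f⟫_ℝ))⁻¹ *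
          (Real.exp (-(1 / 2) * ⟪f, Rj f⟫_ℝ) * ∫ n, Real.exp (-(1 / 2) * ‖f - lap (ι n)‖ ^ 2) ∂μj) := by
        rw [inv_mul_cancel_left₀ (Real.exp_ne_zero _)]
    _ = (Real.exp (-(1 / 2) * ⟪f, Rj f⟫_ℝ))⁻¹ *
          (Real.exp (-(1 / 2) * ‖f‖ ^ 2) * ∫ n, Real.exp (-(1 / 2) * ‖lap (ι n)‖ ^ 2) ∂μj) := by rw [h]
    _ = (∫ n, Real.exp (-(1 / 2) * ‖lap (ι n)‖ ^ 2) ∂μj) *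
          Real.exp (-(1 / 2) * ‖f‖ ^ 2 + (1 / 2) * ⟪f, Rj f⟫_ℝ) := by
        rw [Real.exp_add, show (1 / 2) * ⟪f, Rj f⟫_ℝ = -(-(1 / 2) * ⟪f, Rj f⟫_ℝ) by ring, Real.exp_neg]
        ring

omit [AddCommGroup W] [Module ℝ W] in
/-- **"Let us apply (2.96) and (1.27) to the denominator":** the denominator of the quotient in (2.95),
`∫dω′↾_Λδ(Q′₁ω′)Πδ_{Ax(y)}(Q_jA+∂₁ω′) · Z′_j⁻¹∫dλ′δ(Q′_jλ′)e^{−½‖∂*A−Δλ′‖²}`, equals `e^{−½‖∂*A‖² + ½⟨∂*A,R_j∂*A⟩}` — the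
`λ′`-factor does not depend on `ω′`, the `ω′`-integral is `1` by (2.96) (`h296`), and (1.27) evaluates the rest.
[cite: Balaban1984PropagatorsII, (2.95)–(2.97) p.240] -/
theorem den_eq (μj : Measure Nj) [μj.IsAddLeftInvariant] (lap : B →ₗ[ℝ] B) (ι : Nj →ₗ[ℝ] B)
    (Kj : Submodule ℝ B) [Kj.HasOrthogonalProjection] (hKj : LinearMap.range (lap ∘ₗ ι) = Kj) (Rj : B →ₗ[ℝ] B)
    (hRj : ∀ g, Rj g = Kj.starProjection g) (hZj : ∫ n, Real.exp (-(1 / 2) * ‖lap (ι n)‖ ^ 2) ∂μj ≠ 0)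
    (ν : Measure N1) (χ : W → ℝ) (w : N1 → W) (h296 : ∫ ω, χ (w ω) ∂ν = 1) (f : B) :
    ∫ ω, χ (w ω) * ((∫ n, Real.exp (-(1 / 2) * ‖lap (ι n)‖ ^ 2) ∂μj)⁻¹ *
        ∫ n, Real.exp (-(1 / 2) * ‖f - lap (ι n)‖ ^ 2) ∂μj) ∂ν =
      Real.exp (-(1 / 2) * ‖f‖ ^ 2 + (1 / 2) * ⟪f, Rj f⟫_ℝ) := by
  rw [integral_mul_const, h296, one_mul, eq127_j μj lap ι Kj hKj Rj hRj hZj f]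

/-- **(2.95), second line ⇒ (2.97), pointwise in `A`.**  With `E = exp[−½⟨QA,aQA⟩ − ½⟨A,ΔA⟩ + ⟨A,J⟩]`, `X = Z′⁻¹∫dλδ(Q′λ)e^{−½‖∂*A−Δλ‖²}`
and the quotient `NUM/DEN` of (2.95) (numerator and denominator are the same expression in the dummy variables `ω`, `ω′`):
`E · X⁻¹ · NUM · DEN⁻¹ = ∫dω↾_Λδ(Q′₁ω) exp[−½⟨QA,aQA⟩ − ½‖∂A‖² − ½‖(I−P_j)∂*A‖² + ⟨A,J⟩] Πδ_{Ax(y)}(Q_jA+∂₁ω)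
Z′_j⁻¹∫dλ′δ(Q′_jλ′)e^{−½‖∂*A−Δλ′‖²} · X⁻¹` — the integrand of (2.97) at this `A`.  Hypotheses: (2.96) `h296`, `Z′_j ≠ 0`,
`⟨A,ΔA⟩ = ‖∂A‖² + ‖∂*A‖²`, `R_j` the projection onto `ΔN(Q′_j)`, `I − P_j = R_j`.
[cite: Balaban1984PropagatorsII, (2.97) p.240] -/
theorem eq297_of_295 (μj : Measure Nj) [μj.IsAddLeftInvariant] (lap : B →ₗ[ℝ] B) (ι : Nj →ₗ[ℝ] B)
    (Kj : Submodule ℝ B) [Kj.HasOrthogonalProjection] (hKj : LinearMap.range (lap ∘ₗ ι) = Kj) (Rj : B →ₗ[ℝ] B)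
    (hRj : ∀ g, Rj g = Kj.starProjection g) (hZj : ∫ n, Real.exp (-(1 / 2) * ‖lap (ι n)‖ ^ 2) ∂μj ≠ 0)
    (ν : Measure N1) (χ : W → ℝ) (Qv : A →ₗ[ℝ] W) (sh : N1 → W) (μ' : Measure NQ) (κ : NQ →ₗ[ℝ] B) (Zp : ℝ)
    (lapV : A →ₗ[ℝ] A) (curl : A →ₗ[ℝ] T) (dstar : A →ₗ[ℝ] B) (q : A → ℝ) (J a : A)
    (hΔ : ⟪a, lapV a⟫_ℝ = ‖curl a‖ ^ 2 + ‖dstar a‖ ^ 2) (h296 : ∫ ω, χ (Qv a + sh ω) ∂ν = 1) :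
    Real.exp (-(1 / 2) * q a - (1 / 2) * ⟪a, lapV a⟫_ℝ + ⟪a, J⟫_ℝ) *
        (Zp⁻¹ * ∫ m, Real.exp (-(1 / 2) * ‖dstar a - lap (κ m)‖ ^ 2) ∂μ')⁻¹ *
        ((∫ ω, χ (Qv a + sh ω) * ((∫ n, Real.exp (-(1 / 2) * ‖lap (ι n)‖ ^ 2) ∂μj)⁻¹ *
            ∫ n, Real.exp (-(1 / 2) * ‖dstar a - lap (ι n)‖ ^ 2) ∂μj) ∂ν) *
          (∫ ω, χ (Qv a + sh ω) * ((∫ n, Real.exp (-(1 / 2) * ‖lap (ι n)‖ ^ 2) ∂μj)⁻¹ *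
            ∫ n, Real.exp (-(1 / 2) * ‖dstar a - lap (ι n)‖ ^ 2) ∂μj) ∂ν)⁻¹) =
      ∫ ω, Real.exp (-(1 / 2) * q a - (1 / 2) * ‖curl a‖ ^ 2 - (1 / 2) * ‖Rj (dstar a)‖ ^ 2 + ⟪a, J⟫_ℝ) *
          χ (Qv a + sh ω) *
          ((∫ n, Real.exp (-(1 / 2) * ‖lap (ι n)‖ ^ 2) ∂μj)⁻¹ *
            ∫ n, Real.exp (-(1 / 2) * ‖dstar a - lap (ι n)‖ ^ 2) ∂μj) *
          (Zp⁻¹ * ∫ m, Real.exp (-(1 / 2) * ‖dstar a - lap (κ m)‖ ^ 2) ∂μ')⁻¹ ∂ν := by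
  -- the denominator (= the numerator) after (2.96) and (1.27), cf. `den_eq`
  set c : ℝ := (∫ n, Real.exp (-(1 / 2) * ‖lap (ι n)‖ ^ 2) ∂μj)⁻¹ *
    ∫ n, Real.exp (-(1 / 2) * ‖dstar a - lap (ι n)‖ ^ 2) ∂μj with hc
  set X : ℝ := Zp⁻¹ * ∫ m, Real.exp (-(1 / 2) * ‖dstar a - lap (κ m)‖ ^ 2) ∂μ' with hX
  have hcval : c = Real.exp (-(1 / 2) * ‖dstar a‖ ^ 2 + (1 / 2) * ⟪dstar a, Rj (dstar a)⟫_ℝ) := by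
    rw [hc]; exact eq127_j μj lap ι Kj hKj Rj hRj hZj (dstar a)
  have hden' : ∫ ω, χ (Qv a + sh ω) * c ∂ν = c := by
    rw [integral_mul_const, h296, one_mul]
  have hcne : c ≠ 0 := by rw [hcval]; exact Real.exp_ne_zero _
  -- the quotient NUM/DEN is 1
  rw [hden', mul_inv_cancel₀ hcne, mul_one]
  -- the right-hand side: pull the ω-independent factors out of the ω-integral
  have hrhs : ∫ ω, Real.exp (-(1 / 2) * q a - (1 / 2) * ‖curl a‖ ^ 2 - (1 / 2) * ‖Rj (dstar a)‖ ^ 2 + ⟪a, J⟫_ℝ) *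
        χ (Qv a + sh ω) * c * X⁻¹ ∂ν =
      Real.exp (-(1 / 2) * q a - (1 / 2) * ‖curl a‖ ^ 2 - (1 / 2) * ‖Rj (dstar a)‖ ^ 2 + ⟪a, J⟫_ℝ) * c * X⁻¹ := by
    rw [integral_mul_const, integral_mul_const, integral_const_mul, h296, mul_one]
  rw [hrhs, hcval, ← Real.exp_add]
  congr 2
  -- exponent bookkeeping: ⟨A,ΔA⟩ = ‖∂A‖² + ‖∂*A‖² and ⟨f,R_jf⟩ = ‖R_jf‖²
  have hR : ⟪dstar a, Rj (dstar a)⟫_ℝ = ‖Rj (dstar a)‖ ^ 2 := by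
    rw [hRj]; exact inner_starProjection_eq_norm_sq Kj (dstar a)
  rw [hΔ, hR]
  ring

omit [MeasurableSpace N1] [MeasurableAdd Nj] in
/-- The `ω`-integrand of (2.97) in the letters of `…B6Eq2106.eq2105_of_2097_fibre` (whose normalisations `Z⁻¹, Z′_j⁻¹, Z′⁻¹`
are omitted): it is `(Z′·Z′_j⁻¹) ×` `Φ(A)e^{⟨A,J⟩} χ(Q_jA+∂₁ω) ∫dλ′δ(Q′_jλ′)e^{−½‖∂*A−Δλ′‖²} (∫dλδ(Q′λ)e^{−½‖∂*A−Δλ‖²})⁻¹`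
with the invariant weight `Φ(A) = exp[−½⟨QA,aQA⟩ − ½‖∂A‖² − ½‖(I−P_j)∂*A‖²]` (*"the first exponential"* of (2.97)).
[cite: Balaban1984PropagatorsII, (2.97) p.240] -/
theorem eq297_integrand (μj : Measure Nj) (lap : B →ₗ[ℝ] B) (ι : Nj →ₗ[ℝ] B) (Rj : B →ₗ[ℝ] B) (χ : W → ℝ)
    (Qv : A →ₗ[ℝ] W) (sh : N1 → W) (μ' : Measure NQ) (κ : NQ →ₗ[ℝ] B) (Zp : ℝ) (curl : A →ₗ[ℝ] T)
    (dstar : A →ₗ[ℝ] B) (q : A → ℝ) (J a : A) (ω : N1) :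
    Real.exp (-(1 / 2) * q a - (1 / 2) * ‖curl a‖ ^ 2 - (1 / 2) * ‖Rj (dstar a)‖ ^ 2 + ⟪a, J⟫_ℝ) *
          χ (Qv a + sh ω) *
          ((∫ n, Real.exp (-(1 / 2) * ‖lap (ι n)‖ ^ 2) ∂μj)⁻¹ *
            ∫ n, Real.exp (-(1 / 2) * ‖dstar a - lap (ι n)‖ ^ 2) ∂μj) *
          (Zp⁻¹ * ∫ m, Real.exp (-(1 / 2) * ‖dstar a - lap (κ m)‖ ^ 2) ∂μ')⁻¹ =
      (Zp * (∫ n, Real.exp (-(1 / 2) * ‖lap (ι n)‖ ^ 2) ∂μj)⁻¹) *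
        (Real.exp (-(1 / 2) * q a - (1 / 2) * ‖curl a‖ ^ 2 - (1 / 2) * ‖Rj (dstar a)‖ ^ 2) *
            Real.exp ⟪a, J⟫_ℝ * χ (Qv a + sh ω) *
          (∫ n, Real.exp (-(1 / 2) * ‖dstar a - lap (ι n)‖ ^ 2) ∂μj) *
          (∫ m, Real.exp (-(1 / 2) * ‖dstar a - lap (κ m)‖ ^ 2) ∂μ')⁻¹) := by
  rw [Real.exp_add, mul_inv, inv_inv]
  ring

end

end Literature.MathematicalPhysics.QuantumFieldTheory.Balaban1983to89.B6Eq297GaugeFixing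

end
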